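import Summits.HodgeConjecture.HodgeConjecture.Cruxes.BlochSeedDiscOne.SigmaH

/-!
# The P-charged door REDUCES to a P-mass law (strengthen g24, v1.0)

`line stmt-HodgeConjecture-18881 Cruxes/BlochSeedDiscOne/Lines/birth.lean 814a6a70c14e831a stub_rung_pad4_seedAt`

HONESTY LABEL. Nothing in this file is a theorem toward HC / HC_CM / HC_AV / №4 / 26512 / 18881 / H2, and it is not a rung of the line
above. It is a kernel-checked statement ABOUT THE S⁺ SENTENCE OF RECORD `RuleDPlate.SPlus h sigmaH 0`
(`OnAlphabet h ∧ Disj ∧ (A1) ∧ RuleD ∧ HallUp ∧ HallPlusUp 8 ∧ μ ≠ 0 ∧ [Σ-H + 28(r − 4) ≤ 3136] ⇒ ⊥`) on its P-CHARGED branch — the branch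
left open by the axis road (`AxisSPlus`, the `E = 0` regime) and inhabited, WITHOUT the budget, by the twin `PChargedTwin.Dnat`
(`E = −128`, N-mass 2248): evidence for the strengthen lens, typed files, not rungs.

## The reduction (§2)

A design is P-CHARGED when every supported N-cell carries the hub (`PCharged`, same text as `OneSignedShell.PCharged`). On that branch the
two Hall binders of the door are worth exactly `N-mass ≥ P-mass + 8` (`pmass_add_le_nmass_of_hallPlusUp`, the instance `S = P, T = N` of
`HallPlusUp D 8`; the P-mass is positive because `μ ≠ 0` is carried by hub-free cells only, `pmass_pos_of_pcharged`), while the Σ-budget of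
record is worth exactly `N-mass ≤ 58` (`nmass_le_58_of_budget`, via `SigmaH.copies_add_rank_le_of_budget` and `copies + rank = 2·N-mass`).
Hence the door on the P-charged branch FOLLOWS FROM the budget-free, Hall-free

  `PMassLaw h 51 :  OnAlphabet h ∧ Disj ∧ (A1) ∧ RuleD ∧ μ ≠ 0 ∧ PCharged  ⟹  P-mass ≥ 51`      (`sPlusB_pcharged_of_pmassLaw`),

and conversely a P-charged door inhabitant has P-mass `≤ 50` (`pmass_le_50_of_doorInhabitant`). The twin `T_ud` has P-mass 1088; every
S₀⋊S₄-symmetric P-charged RULE-D species has P-mass in the hundreds (memo-34 §5). `PMassLaw 14 51` is the typed S⁺_PC target of record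
for the next seat; its first rigorous rungs (pen, memo-34 §7): the compass cells (hub-free P-cells) number `≥ 15` (a Rao-type bound on the
one-signed class measure), every single-hub N-cell stands on `≥ 2` hub-bearing P-cells, every double-hub N-cell on `≥ 1`.

## What this file does NOT say
It does not prove `PMassLaw 14 51` (OPEN), nor anything off the P-charged branch.
-/

set_option linter.dupNamespace false

namespace Summit.HodgeConjecture.HodgeConjecture.Cruxes.BlochSeedDiscOne.PChargedDoor

open Summit.HodgeConjecture.HodgeConjecture.Cruxes.BlochSeedDiscOne.DepthBoundA4
open Summit.HodgeConjecture.HodgeConjecture.Cruxes.BlochSeedDiscOne.LeggedFloor (RuleD Disj)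
open Summit.HodgeConjecture.HodgeConjecture.Cruxes.BlochSeedDiscOne.HallB136 (HallUp)
open Summit.HodgeConjecture.HodgeConjecture.Cruxes.BlochSeedDiscOne.RuleDPlate (HallPlusUp BudgetClause SPlusB SPlus)
open Summit.HodgeConjecture.HodgeConjecture.Cruxes.BlochSeedDiscOne.SigmaH (sigmaH copies_add_rank_le_of_budget)

/-! ## §1 The P-charged branch -/

/-- hub-free cell: every letter has positive co-level (same text as `OneSignedShell.HubFree`). -/
def HubFree (c : Cell) : Prop := ∀ f : Fin 4, 0 < (c f).colevel

/-- P-CHARGED design: every supported N-cell carries the hub on some factor (same text as `OneSignedShell.PCharged`). -/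
def PCharged (D : Design) : Prop := ∀ y ∈ D.suppN, ∃ f : Fin 4, (y f).colevel = 0

/-- the P-mass and the N-mass of a design. -/
def pmass (D : Design) : ℕ := (D.P.map Prod.snd).sum
/-- N-mass. -/
def nmass (D : Design) : ℕ := (D.N.map Prod.snd).sum

/-- a letter of co-level `0` is `β = 0`. -/
theorem xy_zero_of_colevel {ℓ : Letter} (h : ℓ.colevel = 0) : ℓ.x = 0 ∧ ℓ.y = 0 := by
  unfold Letter.colevel at h
  constructor
  · have : |ℓ.x| = 0 := by have := abs_nonneg ℓ.x; have := abs_nonneg ℓ.y; omega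
    exact abs_eq_zero.mp this
  · have : |ℓ.y| = 0 := by have := abs_nonneg ℓ.x; have := abs_nonneg ℓ.y; omega
    exact abs_eq_zero.mp this

/-- a hub-bearing cell is invisible to the Bloch word `eeee`. -/
theorem cellCoef_eeee_eq_zero {c : Cell} {f : Fin 4} (h : (c f).colevel = 0) : cellCoef c Word.eeee = 0 := by
  unfold cellCoef
  apply Finset.prod_eq_zero (Finset.mem_univ f)
  obtain ⟨hx, hy⟩ := xy_zero_of_colevel h
  show star (c f).beta = 0
  have hb : (c f).beta = 0 := by
    unfold Letter.beta; rw [hx, hy]; rfl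
  rw [hb, star_zero]

/-- a list of naturals with zero sum is pointwise zero (the entries we meet). -/
theorem eq_zero_of_sum_map_eq_zero {L : List (Cell × ℕ)} (h : (L.map Prod.snd).sum = 0) :
    ∀ cm ∈ L, cm.2 = 0 := by
  intro cm hcm
  have hle : cm.2 ≤ (L.map Prod.snd).sum := List.le_sum_of_mem (List.mem_map.2 ⟨cm, hcm, rfl⟩)
  omega

/-- On the P-charged branch `μ` is carried by the P-side alone: the N-side sum of the Bloch word vanishes. -/
theorem sumN_eeee_eq_zero {D : Design} (hpc : PCharged D) :
    (D.N.map fun cm => (cm.2 : GaussianInt) * cellCoef cm.1 Word.eeee).sum = 0 := by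
  apply List.sum_eq_zero
  intro z hz
  obtain ⟨cm, hcm, rfl⟩ := List.mem_map.1 hz
  by_cases hm : cm.2 = 0
  · simp [hm]
  · have hsupp : cm.1 ∈ D.suppN := by
      unfold Design.suppN
      exact List.mem_map.2 ⟨cm, List.mem_filter.2 ⟨hcm, by simp; omega⟩, rfl⟩
    obtain ⟨f, hf⟩ := hpc cm.1 hsupp
    rw [cellCoef_eeee_eq_zero hf, mul_zero]

/-- **P-mass is positive** on the P-charged branch as soon as `μ ≠ 0`. -/
theorem pmass_pos_of_pcharged {D : Design} (hpc : PCharged D) (hμ : D.mu ≠ 0) : 0 < pmass D := by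
  by_contra h0
  have h0' : (D.P.map Prod.snd).sum = 0 := by unfold pmass at h0; omega
  apply hμ
  unfold Design.mu Design.T
  rw [sumN_eeee_eq_zero hpc, zero_sub, neg_eq_zero]
  apply List.sum_eq_zero
  intro z hz
  obtain ⟨cm, hcm, rfl⟩ := List.mem_map.1 hz
  rw [eq_zero_of_sum_map_eq_zero h0' cm hcm]
  simp

/-! ## §2 What the Hall binders and the budget are worth on this branch -/

/-- `HallPlusUp D k` with `S = P`, `T = N`: **`P-mass + k ≤ N-mass`** (needs `P-mass > 0`). -/
theorem pmass_add_le_nmass_of_hallPlusUp {D : Design} {k : ℕ} (hH : HallPlusUp D k) (hpos : 0 < pmass D) :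
    pmass D + k ≤ nmass D :=
  hH D.P (List.Sublist.refl _) hpos D.N (List.Sublist.refl _) (fun _ hcn _ => hcn)

/-- `copies + rank = 2·N-mass`. -/
theorem copies_add_rank_eq (D : Design) : (D.copies : ℤ) + D.rank = 2 * (nmass D : ℤ) := by
  unfold Design.copies Design.rank nmass; push_cast; ring

/-- the Σ-budget of record caps the N-mass at `58` (same three lines as `AxisSPlus.nmass_le_58_of_budget`). -/
theorem nmass_le_58_of_budget (D : Design) (hb : BudgetClause sigmaH 0 D) : nmass D ≤ 58 := by
  have h₁ := copies_add_rank_le_of_budget D hb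
  have h₂ := copies_add_rank_eq D
  omega

/-- hence a P-charged door inhabitant has **P-mass ≤ 50**. -/
theorem pmass_le_50_of_doorInhabitant {D : Design} (hpc : PCharged D) (hH8 : HallPlusUp D 8) (hμ : D.mu ≠ 0)
    (hb : BudgetClause sigmaH 0 D) : pmass D ≤ 50 := by
  have h₁ := pmass_add_le_nmass_of_hallPlusUp hH8 (pmass_pos_of_pcharged hpc hμ)
  have h₂ := nmass_le_58_of_budget D hb
  omega

/-! ## §3 The P-mass law and the reduction -/

/-- **P-MASS LAW** (budget-free, Hall-free): on the height-`h` alphabet a disjoint (A1)-clean RULE-D design with `μ ≠ 0` all of whose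
N-cells carry the hub has P-mass `≥ b`. `PMassLaw 14 51` is the typed S⁺_PC target (OPEN); `T_ud` has P-mass 1088. -/
def PMassLaw (h : ℤ) (b : ℕ) : Prop :=
  ∀ D : Design, D.OnAlphabet h → Disj D → D.A1 → RuleD D → D.mu ≠ 0 → PCharged D → b ≤ pmass D

/-- **THE REDUCTION**: `PMassLaw h 51` closes the door of record on the P-charged branch, at every height. -/
theorem sPlusB_pcharged_of_pmassLaw (h : ℤ) (hl : PMassLaw h 51) :
    SPlusB h (fun D => PCharged D ∧ BudgetClause sigmaH 0 D) := by
  intro D hD hdis h1 hrd _ hH8 hμ hb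
  have h51 := hl D hD hdis h1 hrd hμ hb.1
  have h50 := pmass_le_50_of_doorInhabitant hb.1 hH8 hμ hb.2
  omega

/-- the same with any threshold `b ≥ 51`. -/
theorem sPlusB_pcharged_of_pmassLaw_ge (h : ℤ) {b : ℕ} (hb : 51 ≤ b) (hl : PMassLaw h b) :
    SPlusB h (fun D => PCharged D ∧ BudgetClause sigmaH 0 D) :=
  sPlusB_pcharged_of_pmassLaw h fun D hD hdis h1 hrd hμ hpc => le_trans hb (hl D hD hdis h1 hrd hμ hpc)

/-- monotonicity of the law in the threshold. -/
theorem pmassLaw_mono (h : ℤ) {b b' : ℕ} (hbb : b' ≤ b) (hl : PMassLaw h b) : PMassLaw h b' :=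
  fun D hD hdis h1 hrd hμ hpc => le_trans hbb (hl D hD hdis h1 hrd hμ hpc)

/-- the trivial rung: `PMassLaw h 1` (P-mass is positive). -/
theorem pmassLaw_one (h : ℤ) : PMassLaw h 1 :=
  fun _ _ _ _ _ hμ hpc => pmass_pos_of_pcharged hpc hμ

end Summit.HodgeConjecture.HodgeConjecture.Cruxes.BlochSeedDiscOne.PChargedDoor
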